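import Mathlib
import Literature.MathematicalPhysics.QuantumFieldTheory.Balaban1983to89.B9Eq331LatticeCov

/-!
# [4] p. 398 «All these inequalities are invariant with respect to gauge transformations of U» for the letters of
# record G′, (Q′G′²Q′\*)⁻¹, H′ ((1.91)) and [4]'s H′ ((3.163)) on the (3.25)-lattice carriers; the kernel H′(x, y′) of
# [B8] p. 92 conjugates

statement-level skeleton of published theorems with citation tags; proofs where landed; nothing here is a claim
about the Yang–Mills mass gap

Seat p40 gen 9, Phase 2 (free target C; owner r05 row B8.Eq1.91 ((1.91)–(1.92)), xref r06 rows B9.Eq3.28 / B9.Thm3.1).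
Sources: [Balaban1985BackgroundPropagators] T. Bałaban, *Propagators for lattice gauge theories in a background field*,
CMP 99 (1985) 389–434: p. 398 [PDF 10] (after (3.47)) «All these inequalities are invariant with respect to gauge
transformations of U.»; Cor. 3.6 p. 408 [PDF 20] «Theorems 3.1–3.3 hold for the operators G′(U), (Q′(U)G′²(U)Q′\*(U))⁻¹,
G(U) … This follows from Corollary 3.5 applied to the configuration U′ = U^u, and we have to recall only that all the
results of these theorems are gauge invariant.»; (3.28) p. 395 «U^u(x, x′) = u(x)U(x, x′)u⁻¹(x′)»; (3.31)–(3.33)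
pp. 395–396 (OCR pages p0007, p0008, p0010, p0020 of `paper:balaban1985-cmp99-background-propagators`, read by this
seat).  [Balaban1985RegularSpaces] T. Bałaban, *Spaces of regular gauge field configurations on a lattice and gauge
fixing conditions*, CMP 99 (1985) 75–102: (1.91)–(1.92) p. 91 [PDF 17] «H′ = G′²Q′\*(Q′G′²Q′\*)⁻¹, G′ = (Δ + Q′\*aQ′)⁻¹.
(1.91) They were investigated in [4], and the following inequality can be obtained from the results of this paper:
|(H′X)(x)|, |(∇H′X)(x)| ≦ B′₀[1, (L^jη)⁻¹]|X| for x ∈ Ω_j (1.92)», p. 92 [PDF 18] «where (H′X)(x) = Σ_{y′∈𝔅_k}(L^{j′}η)^d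
H′(x, y′)X(y′)» (OCR pages p0017, p0018 of `paper:balaban1985-cmp99-regular-spaces-gauge-fixing`).

WHY THIS FILE.  `B9Eq333Cov` §4 proves the MECHANISM of the p. 398 sentence abstractly (a kernel K(x, y) and its
conjugate R(u(x))K(x, y)R(u(y))⁻¹ have the same fibrewise norms, `kernel_bound_iff`), for kernels given as data.
`B9Eq331LatticeCov` proves (3.31)–(3.33) for the letters WITH BODIES of the (3.25)-lattice carriers: G′ = `gL`,
(Q′G′²Q′\*)⁻¹ = `cL`, (1.91)'s H′ = `HpL`, [4]'s H′ = `H4`, and D_{U^u}R(u) = R(u(b₋))D_U (`DL_conjT`).  This file joins the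
two: for these letters, EVERY statement about the fibrewise norm profiles x ↦ |λ(x)|, x ↦ |(Tλ)(x)|, b ↦ |(D_U Tλ)(b)| —
which is the shape of each of (3.42)–(3.47) (sup-norms with supports and localisations, weighted L² norms, derivatives
∇_U) and of [B8] (1.92) — holds at the background U iff it holds at U^u; and the kernel H′(x, y′) of p. 92
(`B8Eq191Hprime.kernelOf`) conjugates, H′(U^u)(x, y′) = R(u(x))H′(U)(x, y′)R(u(y_{y′}))⁻¹, so fibrewise kernel bounds
|H′(x, y′)| ≦ β(x, y′) are invariant too.

CONTENT.
§1 GENERIC (two finite site types X, Y, isometry families u_X, u_Y acting by `gaugeE`; T, T′ : L²(Y) → L²(X) with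
   T′R(u_Y) = R(u_X)T): **`profile_iff`** (∀ P, (∀ φ, P(|φ|, |T′φ|)) ⟺ (∀ φ, P(|φ|, |Tφ|))), **`profileD_iff`** (the same
   with a third profile |D′T′φ| / |DTφ| on bonds, given D′R(u_X) = R(u_X(b₋))D), the printed sup-shape
   `supBound_iff` («|(Tφ)(x)| ≦ b(x)|φ|»), **`kernelOf_intertwine`** (T′(x, y′) = u_X(x) T(x, y′) u_Y(y′)⁻¹),
   `kernelProfile_iff`, `kernelBound_iff` («|T(x, y′)v| ≦ β|v|»).
§2 THE LETTERS at U^u = `conjT u τ` ((3.28)): `gL_profile_conjT_iff` / `gL_profileD_conjT_iff` (G′: the shape of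
   (3.42)–(3.47)), `cL_profile_conjT_iff` ((Q′G′²Q′\*)⁻¹, Thm 3.3 / Cor. 3.6), **`HpL_profile_conjT_iff`** /
   **`HpL_profileD_conjT_iff`** ((1.92) both members), **`kernelOf_HpL_conjT`** (p. 92 kernel), `HpL_kernelBound_conjT_iff`,
   `kernelOf_gL_conjT`, `H4_profile_conjT_iff`, `kernelOf_H4_conjT`.

HONEST SCOPE.  (i) No inequality of [4] Thms 3.1–3.3 or of (1.92) is proved here — only their INVARIANCE under U → U^u,
for every background with injective transports, every u : X → O(𝔤), every block system of the carriers; the bounds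
themselves are the business of `B8Ineq192` (abstract kernels) and the B9 rows.  (ii) «Invariant» is read as: the
statement at U^u about R(u_Y)φ is the statement at U about φ, R(u) being a bijection preserving every fibrewise norm;
statements involving other letters (e.g. the Hölder norms (3.40) with parallel transport, `B9Eq340HolderZd`) are
covered only through the three profiles named.  (iii) ∇ is [4]'s covariant derivative D_U of (3.23) modelled by `DL`
on the bond set of the carriers (weights c_b absorbed, cell DIVERGENCE D-b09.24); the p. 398 remark «we may always
replace ∇^η_U by ∇^η_{U′}» is not used.  (iv) Fibre V = any finite-dimensional real inner-product space; u(x) linear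
isometries (R(u(x)) ∈ O(𝔤)).  No row head changes; value = the p. 398 / p. 408 sentences made theorems for the letters
of record, NOT summit progress.
-/

namespace Literature.MathematicalPhysics.QuantumFieldTheory.Balaban1983to89.B8Ineq192GaugeInv

open Literature.MathematicalPhysics.QuantumFieldTheory.Balaban1983to89.B9Thm311Lattice
  Literature.MathematicalPhysics.QuantumFieldTheory.Balaban1983to89.B9Eq325Proj
  Literature.MathematicalPhysics.QuantumFieldTheory.Balaban1983to89.B8Eq191Hprime
  Literature.MathematicalPhysics.QuantumFieldTheory.Balaban1983to89.B8Eq194FirstTerm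
  Literature.MathematicalPhysics.QuantumFieldTheory.Balaban1983to89.B9Eq331LatticeCov
open scoped InnerProductSpace

/-! ## §1  Generic: norm profiles and kernels of intertwined operators -/

section Generic

variable {X : Type*} {Y : Type*} {V : Type*} [NormedAddCommGroup V] [InnerProductSpace ℝ V]
variable [Fintype X] [Fintype Y]
variable (uX : X → V ≃ₗᵢ[ℝ] V) (uY : Y → V ≃ₗᵢ[ℝ] V)

omit [Fintype Y] in
/-- |R(u)λ|(x) = |λ|(x): a gauge transformation preserves every fibrewise norm.
[cite: Balaban1985BackgroundPropagators, (3.28) p. 395, p. 398 (after (3.47))] -/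
theorem norm_gaugeE_apply (f : PiLp 2 (fun _ : X => V)) (x : X) : ‖gaugeE uX f x‖ = ‖f x‖ :=
  (uX x).norm_map (f x)

omit [Fintype X] [Fintype Y] in
/-- |R(u(b₋))F|(b) = |F|(b) on bond functions. [cite: Balaban1985BackgroundPropagators, (3.31) p. 395, p. 398 (after (3.47))] -/
theorem norm_gaugeB_apply (bonds : Finset (X × X)) (F : PiLp 2 (fun _ : ↥bonds => V)) (b : ↥bonds) :
    ‖gaugeB uX bonds F b‖ = ‖F b‖ :=
  (uX b.1.1).norm_map (F b)

variable {T T' : PiLp 2 (fun _ : Y => V) →ₗ[ℝ] PiLp 2 (fun _ : X => V)}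

/-- **The p. 398 mechanism for norm profiles.**  If T′R(u_Y) = R(u_X)T, then every statement about the pair of
profiles (|φ|, |T′φ|) over all φ is the same statement about (|φ|, |Tφ|): R(u_Y) is onto and both R's preserve the
fibrewise norms. [cite: Balaban1985BackgroundPropagators, p. 398 (after (3.47)), Cor. 3.6 p. 408] -/
theorem profile_iff (h : ∀ φ, T' (gaugeE uY φ) = gaugeE uX (T φ)) (P : (Y → ℝ) → (X → ℝ) → Prop) :
    (∀ φ, P (fun c => ‖φ c‖) (fun x => ‖T' φ x‖)) ↔ (∀ φ, P (fun c => ‖φ c‖) (fun x => ‖T φ x‖)) := by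
  constructor
  · intro H φ
    have H' := H (gaugeE uY φ)
    simp only [h, norm_gaugeE_apply] at H'
    exact H'
  · intro H φ'
    obtain ⟨φ, rfl⟩ := (gaugeE uY).surjective φ'
    simp only [h, norm_gaugeE_apply]
    exact H φ

variable {bonds : Finset (X × X)}
  {D D' : PiLp 2 (fun _ : X => V) →ₗ[ℝ] PiLp 2 (fun _ : ↥bonds => V)}

/-- The same with a third profile b ↦ |(D Tφ)(b)| for a covariant bond operator D (D′R(u_X) = R(u_X(b₋))D — [4]'s
∇_U = D_U of (3.23)): the shape of the ∇-members of (3.42)–(3.47) and of (1.92).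
[cite: Balaban1985BackgroundPropagators, p. 398 (after (3.47)), (3.31) p. 395; Balaban1985RegularSpaces, (1.92) p. 91] -/
theorem profileD_iff (h : ∀ φ, T' (gaugeE uY φ) = gaugeE uX (T φ))
    (hD : ∀ f, D' (gaugeE uX f) = gaugeB uX bonds (D f)) (P : (Y → ℝ) → (X → ℝ) → (↥bonds → ℝ) → Prop) :
    (∀ φ, P (fun c => ‖φ c‖) (fun x => ‖T' φ x‖) (fun b => ‖D' (T' φ) b‖))
      ↔ (∀ φ, P (fun c => ‖φ c‖) (fun x => ‖T φ x‖) (fun b => ‖D (T φ) b‖)) := by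
  constructor
  · intro H φ
    have H' := H (gaugeE uY φ)
    simp only [h, hD, norm_gaugeE_apply, norm_gaugeB_apply] at H'
    exact H'
  · intro H φ'
    obtain ⟨φ, rfl⟩ := (gaugeE uY).surjective φ'
    simp only [h, hD, norm_gaugeE_apply, norm_gaugeB_apply]
    exact H φ

/-- The printed sup-shape «|(Tφ)(x)| ≦ b(x)|φ|» (as in (1.92), (3.42)) is invariant.
[cite: Balaban1985RegularSpaces, (1.92) p. 91; Balaban1985BackgroundPropagators, p. 398 (after (3.47))] -/
theorem supBound_iff (h : ∀ φ, T' (gaugeE uY φ) = gaugeE uX (T φ)) (b : X → ℝ) :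
    (∀ φ (M : ℝ), (∀ c, ‖φ c‖ ≤ M) → ∀ x, ‖T' φ x‖ ≤ b x * M)
      ↔ (∀ φ (M : ℝ), (∀ c, ‖φ c‖ ≤ M) → ∀ x, ‖T φ x‖ ≤ b x * M) :=
  profile_iff uX uY h fun n m => ∀ M : ℝ, (∀ c, n c ≤ M) → ∀ x, m x ≤ b x * M

variable [DecidableEq Y]

/-- **Kernels conjugate**: if T′R(u_Y) = R(u_X)T then T′(x, y′) = R(u_X(x)) T(x, y′) R(u_Y(y′))⁻¹ for the kernels of
p. 92 (`kernelOf`: T(x, y′)v = (T(δ_{y′}v))(x)). [cite: Balaban1985RegularSpaces, p. 92 (after (1.92));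
Balaban1985BackgroundPropagators, (3.33) p. 396, p. 398 (after (3.47))] -/
theorem kernelOf_intertwine (h : ∀ φ, T' (gaugeE uY φ) = gaugeE uX (T φ)) (x : X) (y' : Y) (v : V) :
    kernelOf T' x y' v = uX x (kernelOf T x y' ((uY y').symm v)) := by
  have hs : WithLp.toLp 2 (Pi.single y' v : Y → V)
      = gaugeE uY (WithLp.toLp 2 (Pi.single y' ((uY y').symm v) : Y → V)) := by
    ext c
    rw [gaugeE_apply]
    show (Pi.single y' v : Y → V) c = uY c ((Pi.single y' ((uY y').symm v) : Y → V) c)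
    by_cases hc : c = y'
    · subst hc
      rw [Pi.single_eq_same, Pi.single_eq_same, LinearIsometryEquiv.apply_symm_apply]
    · rw [Pi.single_eq_of_ne hc, Pi.single_eq_of_ne hc, map_zero]
  show T' (WithLp.toLp 2 (Pi.single y' v)) x = uX x (T (WithLp.toLp 2 (Pi.single y' ((uY y').symm v))) x)
  rw [hs, h, gaugeE_apply]

/-- Every statement about the profile (|v|, |T′(x, y′)v|) over v ∈ 𝔤 is the same statement for T(x, y′).
[cite: Balaban1985BackgroundPropagators, p. 398 (after (3.47))] -/
theorem kernelProfile_iff (h : ∀ φ, T' (gaugeE uY φ) = gaugeE uX (T φ)) (x : X) (y' : Y) (P : ℝ → ℝ → Prop) :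
    (∀ v, P ‖v‖ ‖kernelOf T' x y' v‖) ↔ (∀ v, P ‖v‖ ‖kernelOf T x y' v‖) := by
  constructor
  · intro H v
    have H' := H (uY y' v)
    rw [kernelOf_intertwine uX uY h, LinearIsometryEquiv.norm_map, LinearIsometryEquiv.symm_apply_apply,
      LinearIsometryEquiv.norm_map] at H'
    exact H'
  · intro H v
    rw [kernelOf_intertwine uX uY h, LinearIsometryEquiv.norm_map, ← (uY y').symm.norm_map v]
    exact H _

/-- Fibrewise kernel bounds «|T(x, y′)| ≦ β» (operator norm on 𝔤) are invariant.
[cite: Balaban1985BackgroundPropagators, p. 398 (after (3.47)); Balaban1985RegularSpaces, p. 92 (after (1.92))] -/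
theorem kernelBound_iff (h : ∀ φ, T' (gaugeE uY φ) = gaugeE uX (T φ)) (x : X) (y' : Y) (β : ℝ) :
    (∀ v, ‖kernelOf T' x y' v‖ ≤ β * ‖v‖) ↔ (∀ v, ‖kernelOf T x y' v‖ ≤ β * ‖v‖) :=
  kernelProfile_iff uX uY h x y' fun n m => m ≤ β * n

end Generic

/-! ## §2  The letters G′, (Q′G′²Q′\*)⁻¹, H′ (1.91), H′ (3.163) at U^u -/

section Letters

variable {X : Type*} {Y : Type*} {V : Type*} [NormedAddCommGroup V] [InnerProductSpace ℝ V]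
variable [Fintype X] [Fintype Y] [FiniteDimensional ℝ V]
variable (u : X → V ≃ₗᵢ[ℝ] V) {τ : X → X → V →ₗ[ℝ] V} {bonds : Finset (X × X)} {cb : X × X → ℝ} {w : Y → X → ℝ}
  {B : Y → Finset X} {Γ : Y → X → List X} {y : Y → X} {a : Y → ℝ}
  (hinj : ∀ x x' : X, Function.Injective (τ x x')) (hcb : ∀ b ∈ bonds, 0 < cb b) (hS : IsBlockSystem bonds w B Γ y)
  (ha : ∀ c, 0 < a c)

/-- **G′: «All these inequalities are invariant»** — every statement about (|λ|, |G′λ|) holds at U^u iff at U, for the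
lattice G′ = (Δ + Q′\*aQ′)⁻¹ of record. [cite: Balaban1985BackgroundPropagators, p. 398 (after (3.47)), (3.33) p. 396] -/
theorem gL_profile_conjT_iff (P : (X → ℝ) → (X → ℝ) → Prop) :
    (∀ f, P (fun x => ‖f x‖) (fun x => ‖gL (conjT u τ) cb a (conjT_injective u hinj) hcb hS ha f x‖))
      ↔ (∀ f, P (fun x => ‖f x‖) (fun x => ‖gL τ cb a hinj hcb hS ha f x‖)) :=
  profile_iff u u (fun f => gL_conjT u hinj hcb hS ha f) P

/-- G′ with the ∇_U-profile b ↦ |(D_U G′λ)(b)| (the shape of (3.42)–(3.47) with derivatives).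
[cite: Balaban1985BackgroundPropagators, p. 398 (after (3.47)), (3.31) p. 395, (3.33) p. 396] -/
theorem gL_profileD_conjT_iff (P : (X → ℝ) → (X → ℝ) → (↥bonds → ℝ) → Prop) :
    (∀ f, P (fun x => ‖f x‖) (fun x => ‖gL (conjT u τ) cb a (conjT_injective u hinj) hcb hS ha f x‖)
        (fun b => ‖DL (conjT u τ) bonds cb (gL (conjT u τ) cb a (conjT_injective u hinj) hcb hS ha f) b‖))
      ↔ (∀ f, P (fun x => ‖f x‖) (fun x => ‖gL τ cb a hinj hcb hS ha f x‖)
        (fun b => ‖DL τ bonds cb (gL τ cb a hinj hcb hS ha f) b‖)) :=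
  profileD_iff u u (fun f => gL_conjT u hinj hcb hS ha f) (fun f => DL_conjT u τ bonds cb f) P

/-- **(Q′G′²Q′\*)⁻¹ (Thm 3.3, Cor. 3.6)**: every statement about (|φ|, |(Q′G′²Q′\*)⁻¹φ|) holds at U^u iff at U.
[cite: Balaban1985BackgroundPropagators, Cor. 3.6 p. 408, (3.33) p. 396] -/
theorem cL_profile_conjT_iff (P : (Y → ℝ) → (Y → ℝ) → Prop) :
    (∀ φ, P (fun c => ‖φ c‖) (fun c => ‖cL (conjT u τ) cb a (conjT_injective u hinj) hcb hS ha φ c‖))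
      ↔ (∀ φ, P (fun c => ‖φ c‖) (fun c => ‖cL τ cb a hinj hcb hS ha φ c‖)) :=
  profile_iff (fun c => u (y c)) (fun c => u (y c)) (fun φ => cL_conjT u hinj hcb hS ha φ) P

/-- **(1.92), first member**: every statement about (|X|, |H′X|) — e.g. «|(H′X)(x)| ≦ B′₀|X| for x ∈ Ω_j» — holds at
U^u iff at U, for the H′ of (1.91). [cite: Balaban1985RegularSpaces, (1.92) p. 91; Balaban1985BackgroundPropagators,
p. 398 (after (3.47)), (3.33) p. 396] -/
theorem HpL_profile_conjT_iff (P : (Y → ℝ) → (X → ℝ) → Prop) :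
    (∀ φ, P (fun c => ‖φ c‖) (fun x => ‖HpL (conjT u τ) cb a (conjT_injective u hinj) hcb hS ha φ x‖))
      ↔ (∀ φ, P (fun c => ‖φ c‖) (fun x => ‖HpL τ cb a hinj hcb hS ha φ x‖)) :=
  profile_iff u (fun c => u (y c)) (fun φ => HpL_conjT u hinj hcb hS ha φ) P

/-- **(1.92), both members**: every statement about (|X|, |H′X|, |∇_U H′X|) holds at U^u iff at U (∇_U = D_U of (3.23)).
[cite: Balaban1985RegularSpaces, (1.92) p. 91; Balaban1985BackgroundPropagators, p. 398 (after (3.47)), (3.31) p. 395] -/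
theorem HpL_profileD_conjT_iff (P : (Y → ℝ) → (X → ℝ) → (↥bonds → ℝ) → Prop) :
    (∀ φ, P (fun c => ‖φ c‖) (fun x => ‖HpL (conjT u τ) cb a (conjT_injective u hinj) hcb hS ha φ x‖)
        (fun b => ‖DL (conjT u τ) bonds cb (HpL (conjT u τ) cb a (conjT_injective u hinj) hcb hS ha φ) b‖))
      ↔ (∀ φ, P (fun c => ‖φ c‖) (fun x => ‖HpL τ cb a hinj hcb hS ha φ x‖)
        (fun b => ‖DL τ bonds cb (HpL τ cb a hinj hcb hS ha φ) b‖)) :=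
  profileD_iff u (fun c => u (y c)) (fun φ => HpL_conjT u hinj hcb hS ha φ) (fun f => DL_conjT u τ bonds cb f) P

/-- The printed sup-shape of (1.92) with a site-dependent constant (B′₀ on Ω_j): invariant.
[cite: Balaban1985RegularSpaces, (1.92) p. 91; Balaban1985BackgroundPropagators, p. 398 (after (3.47))] -/
theorem HpL_supBound_conjT_iff (bx : X → ℝ) :
    (∀ φ (M : ℝ), (∀ c, ‖φ c‖ ≤ M) → ∀ x, ‖HpL (conjT u τ) cb a (conjT_injective u hinj) hcb hS ha φ x‖ ≤ bx x * M)
      ↔ (∀ φ (M : ℝ), (∀ c, ‖φ c‖ ≤ M) → ∀ x, ‖HpL τ cb a hinj hcb hS ha φ x‖ ≤ bx x * M) :=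
  supBound_iff u (fun c => u (y c)) (fun φ => HpL_conjT u hinj hcb hS ha φ) bx

variable [DecidableEq X] in
/-- G′(U^u)(x, x′) = R(u(x)) G′(U)(x, x′) R(u(x′))⁻¹ for the kernel of the lattice G′ (the shape behind (3.33a)).
[cite: Balaban1985BackgroundPropagators, (3.33) p. 396, p. 398 (after (3.47))] -/
theorem kernelOf_gL_conjT (x x' : X) (v : V) :
    kernelOf (gL (conjT u τ) cb a (conjT_injective u hinj) hcb hS ha) x x' v
      = u x (kernelOf (gL τ cb a hinj hcb hS ha) x x' ((u x').symm v)) :=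
  kernelOf_intertwine u u (fun f => gL_conjT u hinj hcb hS ha f) x x' v

/-- **[4]'s H′ of (3.163)**: every statement about (|μ|, |H′₍₄₎μ|) holds at U^u iff at U.
[cite: Balaban1985BackgroundPropagators, (3.163) p. 429, p. 398 (after (3.47)), (3.33) p. 396] -/
theorem H4_profile_conjT_iff (P : (Y → ℝ) → (X → ℝ) → Prop) :
    (∀ μ, P (fun c => ‖μ c‖) (fun x => ‖H4 (qL (conjT u τ) w B Γ y) (LinearMap.adjoint (qL (conjT u τ) w B Γ y))
        (AL a) (gL (conjT u τ) cb a (conjT_injective u hinj) hcb hS ha)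
        (cL (conjT u τ) cb a (conjT_injective u hinj) hcb hS ha) μ x‖))
      ↔ (∀ μ, P (fun c => ‖μ c‖) (fun x => ‖H4 (qL τ w B Γ y) (LinearMap.adjoint (qL τ w B Γ y)) (AL a)
        (gL τ cb a hinj hcb hS ha) (cL τ cb a hinj hcb hS ha) μ x‖)) :=
  profile_iff u (fun c => u (y c)) (fun μ => H4_conjT u hinj hcb hS ha μ) P

variable [DecidableEq Y]

/-- **The kernel of p. 92 conjugates**: H′(U^u)(x, y′) = R(u(x)) H′(U)(x, y′) R(u(y_{y′}))⁻¹.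
[cite: Balaban1985RegularSpaces, p. 92 (after (1.92)); Balaban1985BackgroundPropagators, (3.33) p. 396] -/
theorem kernelOf_HpL_conjT (x : X) (y' : Y) (v : V) :
    kernelOf (HpL (conjT u τ) cb a (conjT_injective u hinj) hcb hS ha) x y' v
      = u x (kernelOf (HpL τ cb a hinj hcb hS ha) x y' ((u (y y')).symm v)) :=
  kernelOf_intertwine u (fun c => u (y c)) (fun φ => HpL_conjT u hinj hcb hS ha φ) x y' v

/-- Fibrewise kernel bounds «|H′(x, y′)| ≦ β(x, y′)» for (1.91)'s H′ are invariant.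
[cite: Balaban1985RegularSpaces, p. 92 (after (1.92)); Balaban1985BackgroundPropagators, p. 398 (after (3.47))] -/
theorem HpL_kernelBound_conjT_iff (x : X) (y' : Y) (β : ℝ) :
    (∀ v, ‖kernelOf (HpL (conjT u τ) cb a (conjT_injective u hinj) hcb hS ha) x y' v‖ ≤ β * ‖v‖)
      ↔ (∀ v, ‖kernelOf (HpL τ cb a hinj hcb hS ha) x y' v‖ ≤ β * ‖v‖) :=
  kernelBound_iff u (fun c => u (y c)) (fun φ => HpL_conjT u hinj hcb hS ha φ) x y' β

/-- H′₍₄₎(U^u)(x, y′) = R(u(x)) H′₍₄₎(U)(x, y′) R(u(y_{y′}))⁻¹.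
[cite: Balaban1985BackgroundPropagators, (3.163) p. 429, (3.33) p. 396] -/
theorem kernelOf_H4_conjT (x : X) (y' : Y) (v : V) :
    kernelOf (H4 (qL (conjT u τ) w B Γ y) (LinearMap.adjoint (qL (conjT u τ) w B Γ y)) (AL a)
        (gL (conjT u τ) cb a (conjT_injective u hinj) hcb hS ha)
        (cL (conjT u τ) cb a (conjT_injective u hinj) hcb hS ha)) x y' v
      = u x (kernelOf (H4 (qL τ w B Γ y) (LinearMap.adjoint (qL τ w B Γ y)) (AL a) (gL τ cb a hinj hcb hS ha)
          (cL τ cb a hinj hcb hS ha)) x y' ((u (y y')).symm v)) :=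
  kernelOf_intertwine u (fun c => u (y c)) (fun μ => H4_conjT u hinj hcb hS ha μ) x y' v

end Letters

end Literature.MathematicalPhysics.QuantumFieldTheory.Balaban1983to89.B8Ineq192GaugeInv
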